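import Summits.CriticalPhenomena.PercolationContinuityZ3.Theorems.Transplant.SkelWinSeedKitHab
import Summits.CriticalPhenomena.PercolationContinuityZ3.Theorems.Transplant.SkelSeedSlabDeepAvoid
import Summits.CriticalPhenomena.PercolationContinuityZ3.Theorems.Transplant.SkelSlabCube
import Summits.CriticalPhenomena.PercolationContinuityZ3.Theorems.Transplant.SkelStepIVInputs
import Summits.CriticalPhenomena.PercolationContinuityZ3.Theorems.Transplant.SkelRoom
import Summits.CriticalPhenomena.PercolationContinuityZ3.Theorems.Transplant.KNLevelsStepIV
import Summits.CriticalPhenomena.PercolationContinuityZ3.Theorems.Transplant.BoxProdZ2KitStepIV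
import HarnessLib

/-!
# L5.9-Ω of the general node (`HOME/SHEAR-SCOPE.md` §3.9/§3.10 (2)–(3)): the KIT CLAUSE of a window level in the HABITAT graph
# `winGraphIn G Ω` — the corridor residue (C)'s per-level `hkits` — from a PLAIN deep-slab kit of the window `(w₀, R)` PADDED over `Ω`
# (`SkelI.habPad`, `SkelWinSeedKitHab`; design ruling p3-g5, lane INBOX 2026-08-20 21:53:14Z); Ω-twin of p1-g7's `SkelI.kitClause`

builds on p205010 (kernel theorem, internal audit signed; external expert review pending) — nothing in this file uses p205010.
Lane `prim-bschramm`, seat `prim-bschramm-p3` (gen 5); helper file (`--supports stmt-CriticalPhenomena-4575 --as helper`); namespace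
`Transplant.SkelI`, `[DecidableEq V]` binder.

Setting: a plain window `(w₀, R)`, its level-`j` box `Icc (lo - j) (hi + j)`, the deep seed slab (`slabGeomDeep`, scale `ℓs`, tangential
offset `T₀ = 2ℓs + 2 + M`, near depth `r₀`) with near faces `Unear` (the cube faces `SkelI.cubeU` in §3), and a habitat `Ω` with
**`hfull : winLevel Φ w₀ R lo hi j ⊆ Ω`**.  The exploration graph is `Γ := winGraphIn G Ω` (`IsSubbox Γ Wt q D`, `winLevelIn Φ Ω lo hi j ⊆ D`),
the Step-III data are `kitSDataHab … (habPad … (slabGeomDeep …))`, the pinning set is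
`pinSetHab := Win(shell box) R ∪ farSetHab` (`farSetHab` = inner neighbours of the far plain contacts and of the padded contacts).
* §1 `kitSeed_congr`, `mem_kitSeed_pad` (a padded contact's only seed edge is its contact edge), `farSetHab`, `pinSetHab`,
  `pinSetHab_subset_winLevelIn`, `pinSetHab_spec` (the `hT` shape of `slabSeedDeep_notMem_wireSet`);
* §2 **`kitClauseHab`** — `∃ σ S, SHyp (winLDataIn Φ Ω lo hi o Sfin) j σ ∧ σ.N ≤ N ∧ (1 − q^{sB})^k ≤ δ ∧ S ⊆ B⟨j⟩ ∧ S ⊆ D ∧ seeds off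
  wireSet S ∧ faces ⊆ S ∧ hIV` (the clause of `KNLevels.TStep.KitsAt` / p2-g4's `reachOblAtH_concSG`), with a FREE input margin `a ≤ δ²`
  (hp-8 g24's margin fix) and the per-contact dichotomy `hcon` over the `Ω`-contacts: a face vertex in `T`, or — a PLAIN NEAR contact —
  the route hypothesis of `Skel.kit_hIV_of_route` over `Γ = winGraphIn G Ω`;
* §3 **`kitClause_cubeHab`** — §2 with `Unear := SkelI.cubeU` and every room hypothesis discharged by p3-g4's `SkelSlabCube`
  (`nearFaceOK_cube`, `cubeU_geom`, `cube_subset_shellWin`, `cubeFace_subset_innerBoundary` with `Γ`-rungs inside `Ω`).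
[cite: KozmaNitzan2024, §4 Lemma 10, Steps III–V (pp. 19–22)] [cite: GrimmettPercolation1999, §7.2]
-/

noncomputable section

open MeasureTheory
open scoped Classical

namespace Summit.CriticalPhenomena.PercolationContinuityZ3.Theorems
namespace Transplant
namespace SkelI

open Literature.Probability.Percolation Literature.Probability.LatticeModels SimpleGraph KNLevels KozmaNitzan
open Literature.Probability.Percolation.GM (HOct)
open Literature.Barriers.CriticalPhenomena (graphBall graphBall_finite mem_graphBall_self graphBall_mono)
open Skel (winGraph winGraph_adj winLevel mem_winLevel_iff winLData winLData_X inNbr KitGeom fatSeq macroPiece fatRadius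
  cubeCtr cubeFace winGraphIn winGraphIn_adj winGraphIn_le winLevelIn mem_winLevelIn_iff winLevelIn_subset winLDataIn winLDataIn_X
  mem_outerBoundary_winIn_iff cylBall_mono mem_cylBallFin cubeFace_subset_fatSeq)

variable {V : Type} [DecidableEq V] {G : SimpleGraph V} [G.LocallyFinite] (Φ : PlanarSkeletonConc G)

/-! ## §1 Seeds of the padded geometry; the pinning set over `Ω` -/

/-- The seed of `x` only depends on the geometry at `x`. [folklore] -/
theorem kitSeed_congr {κ κ' : KitGeom V} {x : V} (hy : κ'.y x = κ.y x) (hS : κ'.S x = κ.S x) (hU : κ'.U x = κ.U x) :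
    kitSeed G κ' x = kitSeed G κ x := by
  simp only [kitSeed, hy, hS, hU]

/-- **A padded contact's seed edges all contain the contact**: with `S x = U x = {y x}` the seed is the contact edge alone. [folklore] -/
theorem mem_kitSeed_pad {κ : KitGeom V} {x : V} (hS : κ.S x = {κ.y x}) (hU : κ.U x = {κ.y x}) {e : Sym2 V} (he : e ∈ kitSeed G κ x) :
    x ∈ e := by
  rcases mem_kitSeed_cases κ he with rfl | h | ⟨v, hv, u, hu, hvu, rfl⟩
  · exact Sym2.mem_mk_left _ _
  · exfalso
    rw [hS, mem_edgesIn_iff] at h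
    induction e using Sym2.ind with
    | h a b =>
      have ha := h.2 a (Sym2.mem_mk_left a b)
      have hb := h.2 b (Sym2.mem_mk_right a b)
      rw [Finset.mem_singleton] at ha hb
      rw [ha, hb] at h
      exact ((SimpleGraph.mem_edgeSet G).1 h.1).ne rfl
  · exfalso
    rw [hS, Finset.mem_singleton] at hv
    rw [hU, Finset.mem_singleton] at hu
    rw [hv, hu] at hvu
    exact hvu.ne rfl

/-- **The far set over `Ω`**: the inner neighbours (`(habPad … κ).y`) of the `Ω`-contacts of level `j` that are NOT plain near contacts
(padded contacts, and plain contacts with `inNbr x ∉ B_G(w₀, R − r₀)`). [cite: KozmaNitzan2024, §4 p. 21 ("Q ⊆ S")] -/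
def farSetHab (Ω : Finset V) (w₀ : V) (R : ℕ) (lo hi : Site 2) (j r₀ : ℕ) (κ : KitGeom V) : Finset V :=
  ((outerBoundary (winGraphIn G Ω) (winLevelIn Φ Ω lo hi j)).filter fun x =>
      ¬ (x ∈ outerBoundary (winGraph G w₀ R) (winLevel Φ w₀ R lo hi j) ∧
        inNbr Φ w₀ R (Finset.Icc (lo - (j : Site 2)) (hi + (j : Site 2))) x ∈ graphBall G w₀ (R - r₀))).image
    fun x => (habPad Φ Ω w₀ R lo hi j κ).y x

/-- **The pinning set of the window level `j` over `Ω`**: the shell window `Win(Icc (Lo + 2ℓs + 2) (Hi − 2ℓs − 2)) R` together with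
the far set. [cite: KozmaNitzan2024, §4 p. 21 ("Q ⊆ S")] -/
def pinSetHab (Ω : Finset V) (w₀ : V) (R : ℕ) (lo hi : Site 2) (j ℓs r₀ : ℕ) (κ : KitGeom V) : Finset V :=
  Φ.Win w₀ (Finset.Icc ((lo - (j : Site 2)) + ((2 * ℓs + 2 : ℕ) : Site 2)) ((hi + (j : Site 2)) - ((2 * ℓs + 2 : ℕ) : Site 2))) R ∪
    farSetHab Φ Ω w₀ R lo hi j r₀ κ

omit [DecidableEq V] in
/-- The shell window lies in the plain level `B⟨j⟩`. [folklore] -/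
theorem shellWin_subset_winLevel (w₀ : V) (R : ℕ) (lo hi : Site 2) (j ℓs : ℕ) :
    Φ.Win w₀ (Finset.Icc ((lo - (j : Site 2)) + ((2 * ℓs + 2 : ℕ) : Site 2)) ((hi + (j : Site 2)) - ((2 * ℓs + 2 : ℕ) : Site 2))) R ⊆
      winLevel Φ w₀ R lo hi j := fun _ hv =>
  (mem_winLevel_iff Φ).2 ⟨(Φ.mem_Win.1 hv).1, mem_Icc_of_mem_shell (Φ.mem_Win.1 hv).2⟩

section Pin

variable {Φ}
variable {Ω : Finset V} {w₀ : V} {R : ℕ} {lo hi : Site 2} {j ℓs M R' r₀ : ℕ} {Unear : V → Finset V}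

/-- Members of the far set: the inner neighbour of a padded contact or of a far plain contact; either way in the habitat level (the plain
one through `hfull`), with skeleton coordinate OFF the shrunk box `Icc (Lo + 1) (Hi − 1)` (a neighbour of a vertex off the box) and at depth
`> R − r₀` from `w₀` (`1 ≤ r₀ ≤ R`; padded contacts by `inNbrIn_not_mem_graphBall`). [folklore] -/
theorem farSetHab_spec (hfull : winLevel Φ w₀ R lo hi j ⊆ Ω) (hr₀ : 1 ≤ r₀) (hR : r₀ ≤ R) {v : V}
    (hv : v ∈ farSetHab Φ Ω w₀ R lo hi j r₀ (slabGeomDeep Φ w₀ R lo hi j ℓs M R' r₀ Unear)) :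
    v ∈ winLevelIn Φ Ω lo hi j ∧ Φ.φ v ∉ Finset.Icc ((lo - (j : Site 2)) + 1) ((hi + (j : Site 2)) - 1) ∧
      v ∉ graphBall G w₀ (R - r₀) := by
  rw [farSetHab, Finset.mem_image] at hv
  obtain ⟨x, hx, rfl⟩ := hv
  rw [Finset.mem_filter] at hx
  obtain ⟨hxK, hxfar⟩ := hx
  have hxK' : x ∈ outerBoundary (winGraphIn G Ω) (Φ.WinIn Ω (Finset.Icc (lo - (j : Site 2)) (hi + (j : Site 2)))) := hxK
  obtain ⟨-, hxP, -⟩ := (mem_outerBoundary_winIn_iff Φ).1 hxK'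
  -- off the shrunk box: a neighbour of `x`, whose coordinate is off the box
  have hshr : ∀ y, G.Adj x y → Φ.φ y ∉ Finset.Icc ((lo - (j : Site 2)) + 1) ((hi + (j : Site 2)) - 1) := by
    intro y hxy hy
    have h := Skel.φ_mem_Icc_enlarge_of_adj Φ hy hxy.symm
    rw [add_sub_cancel_right, sub_add_cancel] at h
    exact hxP h
  by_cases hp : x ∈ outerBoundary (winGraph G w₀ R) (winLevel Φ w₀ R lo hi j)
  · -- a far plain contact: `y = inNbr x`
    have hfar : inNbr Φ w₀ R (Finset.Icc (lo - (j : Site 2)) (hi + (j : Site 2))) x ∉ graphBall G w₀ (R - r₀) :=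
      fun h => hxfar ⟨hp, h⟩
    rw [(habPad_of_mem hp).1]
    have hp' : x ∈ outerBoundary (winGraph G w₀ R) (Φ.Win w₀ (Finset.Icc (lo - (j : Site 2)) (hi + (j : Site 2))) R) := hp
    obtain ⟨hadj, hyR, hyP⟩ := inNbr_spec Φ hp'
    have hy : (slabGeomDeep Φ w₀ R lo hi j ℓs M R' r₀ Unear).y x =
        inNbr Φ w₀ R (Finset.Icc (lo - (j : Site 2)) (hi + (j : Site 2))) x := rfl
    rw [hy]
    exact ⟨winLevel_subset_winLevelIn hfull ((mem_winLevel_iff Φ).2 ⟨hyR, hyP⟩), hshr _ hadj, hfar⟩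
  · -- a padded contact: `y = inNbrIn x`
    rw [(habPad_of_not_mem hp).1]
    obtain ⟨hadj, -, -⟩ := inNbrIn_spec Φ hxK'
    exact ⟨inNbrIn_mem_winLevelIn Φ hxK, hshr _ hadj, inNbrIn_not_mem_graphBall hxK hp (by omega)⟩

/-- The pinning set lies in the habitat level `B⟨j⟩ = winLevelIn Φ Ω lo hi j`. [folklore] -/
theorem pinSetHab_subset_winLevelIn (hfull : winLevel Φ w₀ R lo hi j ⊆ Ω) (hr₀ : 1 ≤ r₀) (hR : r₀ ≤ R) :
    pinSetHab Φ Ω w₀ R lo hi j ℓs r₀ (slabGeomDeep Φ w₀ R lo hi j ℓs M R' r₀ Unear) ⊆ winLevelIn Φ Ω lo hi j := by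
  intro v hv
  rw [pinSetHab, Finset.mem_union] at hv
  rcases hv with hv | hv
  · exact winLevel_subset_winLevelIn hfull (shellWin_subset_winLevel Φ w₀ R lo hi j ℓs hv)
  · exact (farSetHab_spec hfull hr₀ hR hv).1

/-- Members of the pinning set are shell vertices or far boundary-layer vertices (the `hT` shape of `slabSeedDeep_notMem_wireSet`). [folklore] -/
theorem pinSetHab_spec (hfull : winLevel Φ w₀ R lo hi j ⊆ Ω) (hr₀ : 1 ≤ r₀) (hR : r₀ ≤ R) :
    ∀ v ∈ (↑(pinSetHab Φ Ω w₀ R lo hi j ℓs r₀ (slabGeomDeep Φ w₀ R lo hi j ℓs M R' r₀ Unear)) : Set V),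
      Φ.φ v ∈ Finset.Icc (lo - (j : Site 2)) (hi + (j : Site 2)) ∧
      (Φ.φ v ∈ Finset.Icc ((lo - (j : Site 2)) + ((2 * ℓs + 2 : ℕ) : Site 2)) ((hi + (j : Site 2)) - ((2 * ℓs + 2 : ℕ) : Site 2)) ∨
        (Φ.φ v ∉ Finset.Icc ((lo - (j : Site 2)) + 1) ((hi + (j : Site 2)) - 1) ∧ v ∉ graphBall G w₀ (R - r₀))) := by
  intro v hv
  rw [Finset.mem_coe] at hv
  refine ⟨((mem_winLevelIn_iff Φ).1 (pinSetHab_subset_winLevelIn hfull hr₀ hR hv)).2, ?_⟩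
  rw [pinSetHab, Finset.mem_union] at hv
  rcases hv with hv | hv
  · exact Or.inl (Φ.mem_Win.1 hv).2
  · exact Or.inr (farSetHab_spec hfull hr₀ hR hv).2

end Pin

/-! ## §2 The kit clause over the habitat graph -/

/-- **The kit clause of `KitsAt` / `TargetProperty` for a window level in the habitat graph `winGraphIn G Ω`**, from a plain deep-slab kit of
the window `(w₀, R)` padded over `Ω` (`hfull : winLevel Φ w₀ R lo hi j ⊆ Ω`); input family at a free margin `a ≤ δ²`; per-contact dichotomy
`hcon` over the `Ω`-contacts: a face vertex of the PADDED geometry in `T`, or (plain near contact) the route hypothesis over `winGraphIn G Ω`.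
[cite: KozmaNitzan2024, §4 Lemma 10, Steps III–IV (pp. 19–21)] -/
theorem kitClauseHab [Countable V] {p : unitInterval} (hC : Φ.toPlanarSkeleton.CylSubcritical p) (msel : V → ℕ) {Ssc : Finset ℕ}
    {q : unitInterval} {δ a : ℝ} (hδ : 0 < δ) (ha : a ≤ δ ^ 2)
    (hin : ∀ i ∈ Skel.inputIndex Φ Ssc, 1 - a < (bondPercolation G q).real (Skel.inputEvent Φ hC msel i))
    {M : ℕ} (hM : M ∈ Ssc) (hmsel : ∀ t ∈ Φ.types, msel t ≤ M)
    -- the plain window level and the slab constants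
    {w₀ : V} {R : ℕ} {lo hi : Site 2} {j ℓs R' r₀ rs : ℕ} (hℓs : 1 ≤ ℓs)
    (hwide : ∀ i, (lo - (j : Site 2)) i + 2 * tanOff ℓs M ≤ (hi + (j : Site 2)) i)
    (hR' : ∀ c : V, graphBall G c (ℓs + 2 + 2 * tanOff ℓs M) ∩ Φ.toPlanarSkeleton.cyl c ℓs ⊆ Φ.cylBall c ℓs R')
    (hr₀ : ℓs + 1 + tanOff ℓs M + R' ≤ r₀) (hR : r₀ ≤ R) (hrs : ℓs + 2 + tanOff ℓs M + R' ≤ rs)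
    {Unear : V → Finset V} {cU : ℕ} (hU : NearFaceOKDeep Φ w₀ R lo hi j ℓs M R' r₀ rs cU Unear)
    (hUdef : ∀ x ∈ outerBoundary (winGraph G w₀ R) (winLevel Φ w₀ R lo hi j),
      inNbr Φ w₀ R (Finset.Icc (lo - (j : Site 2)) (hi + (j : Site 2))) x ∈ graphBall G w₀ (R - r₀) →
      Unear x = cubeFace Φ hC (deepCtr Φ w₀ R (lo - (j : Site 2)) (hi + (j : Site 2)) ℓs M x)
        (exitDir Φ w₀ R (lo - (j : Site 2)) (hi + (j : Site 2)) x).1 (exitDir Φ w₀ R (lo - (j : Site 2)) (hi + (j : Site 2)) x).2 ℓs M)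
    (hUsh : ∀ x ∈ outerBoundary (winGraph G w₀ R) (winLevel Φ w₀ R lo hi j), ∀ u ∈ Unear x,
      Φ.φ u ∈ Finset.Icc ((lo - (j : Site 2)) + ((2 * ℓs + 2 : ℕ) : Site 2)) ((hi + (j : Site 2)) - ((2 * ℓs + 2 : ℕ) : Site 2)))
    -- the habitat: full over the level box; ROOM: cubes of plain near contacts in the shell window, faces on their `winGraphIn`-inner boundary
    {Ω : Finset V} (hfull : winLevel Φ w₀ R lo hi j ⊆ Ω)
    (hcube : ∀ x ∈ outerBoundary (winGraph G w₀ R) (winLevel Φ w₀ R lo hi j),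
      inNbr Φ w₀ R (Finset.Icc (lo - (j : Site 2)) (hi + (j : Site 2))) x ∈ graphBall G w₀ (R - r₀) →
      fatSeq Φ hC (cubeCtr Φ (deepCtr Φ w₀ R (lo - (j : Site 2)) (hi + (j : Site 2)) ℓs M x) (exitDir Φ w₀ R (lo - (j : Site 2)) (hi + (j : Site 2)) x).1
          (exitDir Φ w₀ R (lo - (j : Site 2)) (hi + (j : Site 2)) x).2 ℓs M) M ⊆
        Φ.Win w₀ (Finset.Icc ((lo - (j : Site 2)) + ((2 * ℓs + 2 : ℕ) : Site 2)) ((hi + (j : Site 2)) - ((2 * ℓs + 2 : ℕ) : Site 2))) R ∧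
      Unear x ⊆ innerBoundary (winGraphIn G Ω)
        (fatSeq Φ hC (cubeCtr Φ (deepCtr Φ w₀ R (lo - (j : Site 2)) (hi + (j : Site 2)) ℓs M x) (exitDir Φ w₀ R (lo - (j : Site 2)) (hi + (j : Site 2)) x).1
          (exitDir Φ w₀ R (lo - (j : Site 2)) (hi + (j : Site 2)) x).2 ℓs M) M))
    -- the level's source/support, the weighting, the region and the target
    (k : ℕ) (o : V) (Sfin : Finset V) {Wt : Sym2 V → unitInterval} {D T : Finset V}
    (hWD : IsSubbox (winGraphIn G Ω) Wt q D) (hXD : winLevelIn Φ Ω lo hi j ⊆ D) {N : ℕ}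
    (hN : k * (Φ.Δ + 1) ^ (2 * rs) ≤ N)
    (hk : (1 - (q : ℝ) ^ (1 + Φ.Δ * ((Φ.Δ + 1) ^ R' + (tanOff ℓs M + 2)) +
      ((Φ.Δ + 1) ^ R' + (tanOff ℓs M + 2)) * cU)) ^ k ≤ δ)
    -- the per-contact dichotomy over the `Ω`-contacts
    (hcon : ∀ x ∈ outerBoundary (winGraphIn G Ω) (winLevelIn Φ Ω lo hi j),
      (∃ u ∈ (habPad Φ Ω w₀ R lo hi j (slabGeomDeep Φ w₀ R lo hi j ℓs M R' r₀ Unear)).U x, u ∈ T) ∨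
      (x ∈ outerBoundary (winGraph G w₀ R) (winLevel Φ w₀ R lo hi j) ∧
        inNbr Φ w₀ R (Finset.Icc (lo - (j : Site 2)) (hi + (j : Site 2))) x ∈ graphBall G w₀ (R - r₀) ∧ ∀ t ∈ Φ.types,
        (∀ M' ∈ Ssc, 1 - a < (bondPercolation G q).real (UniqZone.zone G (fatSeq Φ hC (cubeCtr Φ (deepCtr Φ w₀ R (lo - (j : Site 2)) (hi + (j : Site 2)) ℓs M x) (exitDir Φ w₀ R (lo - (j : Site 2)) (hi + (j : Site 2)) x).1 (exitDir Φ w₀ R (lo - (j : Site 2)) (hi + (j : Site 2)) x).2 ℓs M)) (msel t) M') ∧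
          ∀ g' : HOct 2, 1 - a < (bondPercolation G q).real
            (linkIn (↑(fatSeq Φ hC (cubeCtr Φ (deepCtr Φ w₀ R (lo - (j : Site 2)) (hi + (j : Site 2)) ℓs M x) (exitDir Φ w₀ R (lo - (j : Site 2)) (hi + (j : Site 2)) x).1 (exitDir Φ w₀ R (lo - (j : Site 2)) (hi + (j : Site 2)) x).2 ℓs M) M')) (fatSeq Φ hC (cubeCtr Φ (deepCtr Φ w₀ R (lo - (j : Site 2)) (hi + (j : Site 2)) ℓs M x) (exitDir Φ w₀ R (lo - (j : Site 2)) (hi + (j : Site 2)) x).1 (exitDir Φ w₀ R (lo - (j : Site 2)) (hi + (j : Site 2)) x).2 ℓs M) (msel t)) (macroPiece Φ (cubeCtr Φ (deepCtr Φ w₀ R (lo - (j : Site 2)) (hi + (j : Site 2)) ℓs M x) (exitDir Φ w₀ R (lo - (j : Site 2)) (hi + (j : Site 2)) x).1 (exitDir Φ w₀ R (lo - (j : Site 2)) (hi + (j : Site 2)) x).2 ℓs M) M' (fatRadius Φ hC M') g'))) →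
        ∃ Qt Ft : Finset V, Ft ⊆ T ∧ Qt ⊆ D ∧ (∀ u ∈ Qt, ∀ v ∈ Qt, G.Adj u v → (winGraphIn G Ω).Adj u v) ∧
          Disjoint Ft (fatSeq Φ hC (cubeCtr Φ (deepCtr Φ w₀ R (lo - (j : Site 2)) (hi + (j : Site 2)) ℓs M x) (exitDir Φ w₀ R (lo - (j : Site 2)) (hi + (j : Site 2)) x).1 (exitDir Φ w₀ R (lo - (j : Site 2)) (hi + (j : Site 2)) x).2 ℓs M) M) ∧
          1 - δ ^ 2 < (prodBernoulli Wt).real (linkIn (↑Qt) (fatSeq Φ hC (cubeCtr Φ (deepCtr Φ w₀ R (lo - (j : Site 2)) (hi + (j : Site 2)) ℓs M x) (exitDir Φ w₀ R (lo - (j : Site 2)) (hi + (j : Site 2)) x).1 (exitDir Φ w₀ R (lo - (j : Site 2)) (hi + (j : Site 2)) x).2 ℓs M) (msel t)) Ft))) :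
    ∃ (σ : SData V) (S : Finset V), SHyp (winLDataIn Φ Ω lo hi o Sfin) j σ ∧ σ.N ≤ N ∧
      (1 - (q : ℝ) ^ σ.sB) ^ σ.k ≤ δ ∧ S ⊆ (winLDataIn Φ Ω lo hi o Sfin).X j ∧ S ⊆ D ∧
      (∀ x ∈ σ.K, ∀ e ∈ σ.seed x, e ∉ wireSet (↑S : Set V)) ∧ (∀ x ∈ σ.K, σ.face x ⊆ S) ∧
      (∀ x ∈ σ.K, 1 - 3 * δ ≤ (prodBernoulli Wt).real {ω | ∃ u ∈ σ.face x,
        1 - δ < (prodBernoulli (pinW Wt (wireSet (↑S : Set V)) ω)).real (⋃ t ∈ T, openConnIn (↑D : Set V) u t)}) := by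
  set κ := slabGeomDeep Φ w₀ R lo hi j ℓs M R' r₀ Unear with hκ
  set Spin := pinSetHab Φ Ω w₀ R lo hi j ℓs r₀ κ with hSpin
  have hOK := kitOK_slabDeep Φ hwide hR' hr₀ hR hrs hU
  have hr₀1 : 1 ≤ r₀ := by omega
  have hrs1 : 1 ≤ rs := by omega
  have hcS1 : 1 ≤ (Φ.Δ + 1) ^ R' + (tanOff ℓs M + 2) := by omega
  have hOKh : KitOKHab Φ Ω lo hi j rs ((Φ.Δ + 1) ^ R' + (tanOff ℓs M + 2)) cU (habPad Φ Ω w₀ R lo hi j κ) :=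
    kitOKHab_pad hOK hfull hrs1 hcS1 hU.one_le
  have hSX : Spin ⊆ winLevelIn Φ Ω lo hi j := pinSetHab_subset_winLevelIn hfull hr₀1 hR
  have hSD : Spin ⊆ D := hSX.trans hXD
  have ha' : 1 - δ ^ 2 ≤ 1 - a := by linarith
  -- faces lie in the pinning set
  have hface : ∀ x ∈ outerBoundary (winGraphIn G Ω) (winLevelIn Φ Ω lo hi j), (habPad Φ Ω w₀ R lo hi j κ).U x ⊆ Spin := by
    intro x hx u hu
    rw [hSpin, pinSetHab, Finset.mem_union]
    by_cases hp : x ∈ outerBoundary (winGraph G w₀ R) (winLevel Φ w₀ R lo hi j)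
    · rw [(habPad_of_mem hp).2.2] at hu
      simp only [hκ, slabGeomDeep] at hu
      split_ifs at hu with hnear
      · left
        rw [Φ.mem_Win]
        exact ⟨((mem_winLevel_iff Φ).1 (hU.sub x hp hnear hu)).1, hUsh x hp u hu⟩
      · right
        rw [Finset.mem_singleton] at hu
        rw [hu, farSetHab, Finset.mem_image]
        refine ⟨x, Finset.mem_filter.2 ⟨hx, fun h => hnear h.2⟩, ?_⟩
        rw [(habPad_of_mem hp).1]
        rfl
    · rw [(habPad_of_not_mem hp).2.2, Finset.mem_singleton] at hu
      right
      rw [hu, farSetHab, Finset.mem_image]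
      exact ⟨x, Finset.mem_filter.2 ⟨hx, fun h => hp h.1⟩, (habPad_of_not_mem hp).1⟩
  refine ⟨kitSDataHab Φ Ω lo hi j (habPad Φ Ω w₀ R lo hi j κ) rs ((Φ.Δ + 1) ^ R' + (tanOff ℓs M + 2)) cU k, Spin,
    shyp_kitHab hOKh o Sfin k, hN, hk, by rw [winLDataIn_X]; exact hSX, hSD, fun x hx e he => ?_, fun x hx => ?_, fun x hx => ?_⟩
  · -- seeds avoid the pairs of the pinning set
    rw [kitSDataHab_K] at hx
    rw [kitSDataHab_seed] at he
    by_cases hp : x ∈ outerBoundary (winGraph G w₀ R) (winLevel Φ w₀ R lo hi j)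
    · rw [kitSeed_congr (habPad_of_mem hp).1 (habPad_of_mem hp).2.1 (habPad_of_mem hp).2.2] at he
      exact slabSeedDeep_notMem_wireSet Φ hℓs hwide hUsh hp (pinSetHab_spec hfull hr₀1 hR) he
    · intro hw
      have hS1 : (habPad Φ Ω w₀ R lo hi j κ).S x = {(habPad Φ Ω w₀ R lo hi j κ).y x} := by
        rw [(habPad_of_not_mem hp).2.1, (habPad_of_not_mem hp).1]
      have hU1 : (habPad Φ Ω w₀ R lo hi j κ).U x = {(habPad Φ Ω w₀ R lo hi j κ).y x} := by
        rw [(habPad_of_not_mem hp).2.2, (habPad_of_not_mem hp).1]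
      have hxS : x ∈ Spin := Finset.mem_coe.1 (hw.1 x (mem_kitSeed_pad hS1 hU1 he))
      have hx' : x ∈ outerBoundary (winGraphIn G Ω) (Φ.WinIn Ω (Finset.Icc (lo - (j : Site 2)) (hi + (j : Site 2)))) := hx
      exact ((mem_outerBoundary_winIn_iff Φ).1 hx').2.1 ((mem_winLevelIn_iff Φ).1 (hSX hxS)).2
  · rw [kitSDataHab_K] at hx; rw [kitSDataHab_face]; exact hface x hx
  · -- Step IV: face-in-target shortcut, or (plain near contact) the route over `winGraphIn G Ω`
    rw [kitSDataHab_K] at hx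
    rw [kitSDataHab_face]
    rcases hcon x hx with ⟨u, hu, huT⟩ | ⟨hp, hnear, hroute⟩
    · exact hIV_of_mem_face hδ hu huT (hSD (hface x hx hu))
    · have hUx : (habPad Φ Ω w₀ R lo hi j κ).U x = Unear x := by
        rw [(habPad_of_mem hp).2.2]
        simp only [hκ, slabGeomDeep, if_pos hnear]
      rw [hUx]
      obtain ⟨hcS, hcib⟩ := hcube x hp hnear
      have hcS' : fatSeq Φ hC (cubeCtr Φ (deepCtr Φ w₀ R (lo - (j : Site 2)) (hi + (j : Site 2)) ℓs M x) (exitDir Φ w₀ R (lo - (j : Site 2)) (hi + (j : Site 2)) x).1 (exitDir Φ w₀ R (lo - (j : Site 2)) (hi + (j : Site 2)) x).2 ℓs M) M ⊆ Spin :=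
        fun v hv => by rw [hSpin, pinSetHab]; exact Finset.mem_union_left _ (hcS hv)
      have hcΩ : fatSeq Φ hC (cubeCtr Φ (deepCtr Φ w₀ R (lo - (j : Site 2)) (hi + (j : Site 2)) ℓs M x) (exitDir Φ w₀ R (lo - (j : Site 2)) (hi + (j : Site 2)) x).1 (exitDir Φ w₀ R (lo - (j : Site 2)) (hi + (j : Site 2)) x).2 ℓs M) M ⊆ Ω :=
        fun v hv => hfull (shellWin_subset_winLevel Φ w₀ R lo hi j ℓs (hcS hv))
      have hUg : Unear x = macroPiece Φ (cubeCtr Φ (deepCtr Φ w₀ R (lo - (j : Site 2)) (hi + (j : Site 2)) ℓs M x) (exitDir Φ w₀ R (lo - (j : Site 2)) (hi + (j : Site 2)) x).1 (exitDir Φ w₀ R (lo - (j : Site 2)) (hi + (j : Site 2)) x).2 ℓs M) M (fatRadius Φ hC M) (Skel.faceElt (exitDir Φ w₀ R (lo - (j : Site 2)) (hi + (j : Site 2)) x).1 (exitDir Φ w₀ R (lo - (j : Site 2)) (hi + (j : Site 2)) x).2) := by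
        rw [hUdef x hp hnear, Skel.cubeFace]
      obtain ⟨t, ht, hall⟩ := Skel.exists_inputs_at_center_all Φ hC msel hin (cubeCtr Φ (deepCtr Φ w₀ R (lo - (j : Site 2)) (hi + (j : Site 2)) ℓs M x) (exitDir Φ w₀ R (lo - (j : Site 2)) (hi + (j : Site 2)) x).1 (exitDir Φ w₀ R (lo - (j : Site 2)) (hi + (j : Site 2)) x).2 ℓs M)
      obtain ⟨h1, h2⟩ := Skel.inputs_at_center_of_le Φ hC (winGraphIn_le G Ω) hWD (hcS'.trans hSD)
        (Skel.adj_winGraphIn_of_subset hcΩ) ((hall M hM).1.trans_le' ha') (fun g => ((hall M hM).2 g).trans_le' ha')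
      obtain ⟨Qt, Ft, hFT, hQD, -, hdisj, h3⟩ := hroute t ht hall
      have hkn := Skel.fatSeq_monotone Φ hC (cubeCtr Φ (deepCtr Φ w₀ R (lo - (j : Site 2)) (hi + (j : Site 2)) ℓs M x) (exitDir Φ w₀ R (lo - (j : Site 2)) (hi + (j : Site 2)) x).1 (exitDir Φ w₀ R (lo - (j : Site 2)) (hi + (j : Site 2)) x).2 ℓs M) (hmsel t ht)
      have h2' := h2 (Skel.faceElt (exitDir Φ w₀ R (lo - (j : Site 2)) (hi + (j : Site 2)) x).1 (exitDir Φ w₀ R (lo - (j : Site 2)) (hi + (j : Site 2)) x).2)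
      rw [← hUg] at h2'
      exact stepIV_in (G := winGraphIn G Ω) (S := Spin) hWD hFT hQD _ hkn hcS' hcib hdisj hδ (Rg := (↑D : Set V))
        (Finset.coe_subset.2 (hcS'.trans hSD)) (Finset.coe_subset.2 hQD) h1 h2' h3

/-! ## §3 The kit clause over the habitat graph with cube faces -/

/-- **The kit clause over `winGraphIn G Ω` with the Lemma-9 cube faces** `Unear := SkelI.cubeU` behind the deep slab (box sides `≥ 2T₀`,
`M + 1 ≤ ℓs`): every room hypothesis of `kitClauseHab` discharged by `SkelSlabCube` — remaining inputs: the input family, the nine slab/cube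
constants, `hfull`, the subbox weighting of the habitat graph, the counts, and the per-contact dichotomy.
[cite: KozmaNitzan2024, §4 Lemma 10, Steps III–IV (pp. 19–21)] -/
theorem kitClause_cubeHab [Countable V] {p : unitInterval} (hC : Φ.toPlanarSkeleton.CylSubcritical p) (msel : V → ℕ) {Ssc : Finset ℕ}
    {q : unitInterval} {δ a : ℝ} (hδ : 0 < δ) (ha : a ≤ δ ^ 2)
    (hin : ∀ i ∈ Skel.inputIndex Φ Ssc, 1 - a < (bondPercolation G q).real (Skel.inputEvent Φ hC msel i))
    {M : ℕ} (hM : M ∈ Ssc) (hmsel : ∀ t ∈ Φ.types, msel t ≤ M)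
    {w₀ : V} {R : ℕ} {lo hi : Site 2} {j ℓs R' r₀ rs : ℕ} (hMℓ : M + 1 ≤ ℓs)
    (hwide : ∀ i, (lo - (j : Site 2)) i + 2 * tanOff ℓs M ≤ (hi + (j : Site 2)) i)
    (hR'₁ : Φ.cylRadMax ℓs (ℓs + 2 + 2 * tanOff ℓs M) ≤ R') (hR'₂ : Φ.cylRadMax ℓs (ℓs + 2 + M + fatRadius Φ hC M) ≤ R')
    (hr₀₁ : ℓs + 1 + tanOff ℓs M + R' ≤ r₀) (hr₀₂ : 2 * ℓs + 2 + tanOff ℓs M + M + fatRadius Φ hC M ≤ r₀) (hR : r₀ ≤ R)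
    (hrs₁ : ℓs + 2 + tanOff ℓs M + R' ≤ rs) (hrs₂ : 2 * ℓs + 3 + tanOff ℓs M + M + fatRadius Φ hC M ≤ rs)
    {Ω : Finset V} (hfull : winLevel Φ w₀ R lo hi j ⊆ Ω)
    (k : ℕ) (o : V) (Sfin : Finset V) {Wt : Sym2 V → unitInterval} {D T : Finset V}
    (hWD : IsSubbox (winGraphIn G Ω) Wt q D) (hXD : winLevelIn Φ Ω lo hi j ⊆ D) {N : ℕ}
    (hN : k * (Φ.Δ + 1) ^ (2 * rs) ≤ N)
    (hk : (1 - (q : ℝ) ^ (1 + Φ.Δ * ((Φ.Δ + 1) ^ R' + (tanOff ℓs M + 2)) +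
      ((Φ.Δ + 1) ^ R' + (tanOff ℓs M + 2)) * (Φ.Δ + 1) ^ fatRadius Φ hC M)) ^ k ≤ δ)
    (hcon : ∀ x ∈ outerBoundary (winGraphIn G Ω) (winLevelIn Φ Ω lo hi j),
      (∃ u ∈ (habPad Φ Ω w₀ R lo hi j (slabGeomDeep Φ w₀ R lo hi j ℓs M R' r₀ (cubeU Φ hC w₀ R lo hi j ℓs M))).U x, u ∈ T) ∨
      (x ∈ outerBoundary (winGraph G w₀ R) (winLevel Φ w₀ R lo hi j) ∧
        inNbr Φ w₀ R (Finset.Icc (lo - (j : Site 2)) (hi + (j : Site 2))) x ∈ graphBall G w₀ (R - r₀) ∧ ∀ t ∈ Φ.types,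
        (∀ M' ∈ Ssc, 1 - a < (bondPercolation G q).real (UniqZone.zone G (fatSeq Φ hC (cubeCtr Φ (deepCtr Φ w₀ R (lo - (j : Site 2)) (hi + (j : Site 2)) ℓs M x) (exitDir Φ w₀ R (lo - (j : Site 2)) (hi + (j : Site 2)) x).1 (exitDir Φ w₀ R (lo - (j : Site 2)) (hi + (j : Site 2)) x).2 ℓs M)) (msel t) M') ∧
          ∀ g' : HOct 2, 1 - a < (bondPercolation G q).real
            (linkIn (↑(fatSeq Φ hC (cubeCtr Φ (deepCtr Φ w₀ R (lo - (j : Site 2)) (hi + (j : Site 2)) ℓs M x) (exitDir Φ w₀ R (lo - (j : Site 2)) (hi + (j : Site 2)) x).1 (exitDir Φ w₀ R (lo - (j : Site 2)) (hi + (j : Site 2)) x).2 ℓs M) M')) (fatSeq Φ hC (cubeCtr Φ (deepCtr Φ w₀ R (lo - (j : Site 2)) (hi + (j : Site 2)) ℓs M x) (exitDir Φ w₀ R (lo - (j : Site 2)) (hi + (j : Site 2)) x).1 (exitDir Φ w₀ R (lo - (j : Site 2)) (hi + (j : Site 2)) x).2 ℓs M) (msel t)) (macroPiece Φ (cubeCtr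 Φ (deepCtr Φ w₀ R (lo - (j : Site 2)) (hi + (j : Site 2)) ℓs M x) (exitDir Φ w₀ R (lo - (j : Site 2)) (hi + (j : Site 2)) x).1 (exitDir Φ w₀ R (lo - (j : Site 2)) (hi + (j : Site 2)) x).2 ℓs M) M' (fatRadius Φ hC M') g'))) →
        ∃ Qt Ft : Finset V, Ft ⊆ T ∧ Qt ⊆ D ∧ (∀ u ∈ Qt, ∀ v ∈ Qt, G.Adj u v → (winGraphIn G Ω).Adj u v) ∧
          Disjoint Ft (fatSeq Φ hC (cubeCtr Φ (deepCtr Φ w₀ R (lo - (j : Site 2)) (hi + (j : Site 2)) ℓs M x) (exitDir Φ w₀ R (lo - (j : Site 2)) (hi + (j : Site 2)) x).1 (exitDir Φ w₀ R (lo - (j : Site 2)) (hi + (j : Site 2)) x).2 ℓs M) M) ∧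
          1 - δ ^ 2 < (prodBernoulli Wt).real (linkIn (↑Qt) (fatSeq Φ hC (cubeCtr Φ (deepCtr Φ w₀ R (lo - (j : Site 2)) (hi + (j : Site 2)) ℓs M x) (exitDir Φ w₀ R (lo - (j : Site 2)) (hi + (j : Site 2)) x).1 (exitDir Φ w₀ R (lo - (j : Site 2)) (hi + (j : Site 2)) x).2 ℓs M) (msel t)) Ft))) :
    ∃ (σ : SData V) (S : Finset V), SHyp (winLDataIn Φ Ω lo hi o Sfin) j σ ∧ σ.N ≤ N ∧
      (1 - (q : ℝ) ^ σ.sB) ^ σ.k ≤ δ ∧ S ⊆ (winLDataIn Φ Ω lo hi o Sfin).X j ∧ S ⊆ D ∧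
      (∀ x ∈ σ.K, ∀ e ∈ σ.seed x, e ∉ wireSet (↑S : Set V)) ∧ (∀ x ∈ σ.K, σ.face x ⊆ S) ∧
      (∀ x ∈ σ.K, 1 - 3 * δ ≤ (prodBernoulli Wt).real {ω | ∃ u ∈ σ.face x,
        1 - δ < (prodBernoulli (pinW Wt (wireSet (↑S : Set V)) ω)).real (⋃ t ∈ T, openConnIn (↑D : Set V) u t)}) := by
  have hℓs : 1 ≤ ℓs := by omega
  have hR' : ∀ c : V, graphBall G c (ℓs + 2 + 2 * tanOff ℓs M) ∩ Φ.toPlanarSkeleton.cyl c ℓs ⊆ Φ.cylBall c ℓs R' :=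
    fun c v hv => cylBall_mono Φ c le_rfl hR'₁ (Φ.prism_subset_cylBall c hℓs (ℓs + 2 + 2 * tanOff ℓs M) ⟨hv.1, hv.2⟩)
  have hU := nearFaceOK_cube Φ hC (w₀ := w₀) hMℓ hwide hR'₂ hr₀₂ hR hrs₂ (le_refl ((Φ.Δ + 1) ^ fatRadius Φ hC M))
  have hOK := kitOK_slabDeep Φ hwide hR' hr₀₁ hR hrs₁ hU
  refine kitClauseHab Φ hC msel hδ ha hin hM hmsel hℓs hwide hR' hr₀₁ hR hrs₁ hU (fun x _ _ => rfl)
    (fun x hx u hu => (cubeU_geom Φ hC hwide hx hu).2.2) hfull (fun x hx hnear => ⟨cube_subset_shellWin Φ hC hwide hr₀₂ hR hx hnear, ?_⟩)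
    k o Sfin hWD hXD hN hk hcon
  -- the cube face lies on the `winGraphIn G Ω`-inner boundary of its cube: face and slab cylinder inside `Ω`
  have hcube := cube_subset_shellWin Φ hC hwide hr₀₂ hR hx hnear
  rw [cubeU]
  refine cubeFace_subset_innerBoundary Φ hC hMℓ fun u hu v hv hvu => (winGraphIn_adj G).2 ⟨hvu.symm, ?_, ?_⟩
  · exact hfull (shellWin_subset_winLevel Φ w₀ R lo hi j ℓs (hcube (cubeFace_subset_fatSeq Φ hC _ _ _ ℓs M hu)))
  · have hv' : v ∈ Φ.cylBall (deepCtr Φ w₀ R (lo - (j : Site 2)) (hi + (j : Site 2)) ℓs M x) ℓs R' := cylBall_mono Φ _ le_rfl hR'₂ hv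
    have hvS : v ∈ (slabGeomDeep Φ w₀ R lo hi j ℓs M R' r₀ (cubeU Φ hC w₀ R lo hi j ℓs M)).S x := by
      simp only [slabGeomDeep, if_pos hnear]
      exact Finset.mem_union_right _ ((mem_cylBallFin Φ).2 hv')
    exact hfull (hOK.S_sub x hx hvS)

end SkelI
end Transplant
end Summit.CriticalPhenomena.PercolationContinuityZ3.Theorems

end
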